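import Summits.QuantumFields.YangMills.Theses.DualityDefect
import HarnessLib

/-!
# Route `DualityDefect` (YangMills): the assembly item (stmt-QuantumFields-11703) holds

`InfraredFall → UltravioletRise → SinglePeak → DefectUnimodal` — a genuine (if elementary) statement about the two
correlation sequences `A μ n`, `B μ n` of a limit state: ultraviolet RISE of the ratio below the scale `ℓ β → ∞`, infrared
FALL eventually, and the single-peak rule «once the ratio fails to rise at some `n ≥ t₀`, it strictly falls at `n + 1`» give a
unique turning point `t⋆ ≥ ℓ β`: rise on `[t₀, t⋆)`, non-rise at `t⋆`, strict fall after `t⋆`.  Proof: the abstract peak lemma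
`exists_peak_of_rise_fall_singlePeak` (first non-rise index `≥ max (ℓ β) t₀` by `Nat.find`, which exists by the infrared fall;
minimality gives the rise below it; the single-peak rule propagates the fall by induction), instantiated at the route's
`A`, `B` and limit-point sets.  Nothing is asserted about Yang–Mills; the three cruxes remain open; no summit statement is
proved (width seat ym-t4-w17 g0, free hands; the item carried unlanded refuter/grounder candidate proofs of 2026-08-15).
-/

set_option autoImplicit false

namespace Summit.QuantumFields.YangMills.Theorems

open Filter

/-- **Abstract peak lemma.** For families of real sequences `A μ`, `B μ` indexed by states `μ ∈ M β`: eventual infrared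
fall (for `β > 0`), ultraviolet rise on `[t₀, ℓ β)` (for `β ≥ β₀`, `ℓ → ∞`) and the single-peak rule give, for `β` large,
a turning point `t⋆ ≥ ℓ β` with rise on `[t₀, t⋆)`, non-rise at `t⋆` and strict fall after `t⋆`. [folklore] -/
theorem exists_peak_of_rise_fall_singlePeak {ι : Type*} (A B : ι → ℕ → ℝ) (M : ℝ → Set ι)
    (hIF : ∀ β : ℝ, 0 < β → ∀ μ ∈ M β, ∃ n₀ : ℕ, ∀ n : ℕ, n₀ ≤ n →
      0 < A μ n ∧ 0 < B μ n ∧ B μ (n + 1) * A μ n < B μ n * A μ (n + 1))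
    (hUV : ∃ (β₀ : ℝ) (t₀ : ℕ) (ℓ : ℝ → ℕ), Tendsto ℓ atTop atTop ∧ ∀ β : ℝ, β₀ ≤ β → ∀ μ ∈ M β,
      ∀ n : ℕ, t₀ ≤ n → n < ℓ β → 0 < A μ n ∧ 0 < B μ n ∧ B μ n * A μ (n + 1) < B μ (n + 1) * A μ n)
    (hSP : ∃ (β₀ : ℝ) (t₀ : ℕ), ∀ β : ℝ, β₀ ≤ β → ∀ μ ∈ M β, ∀ n : ℕ, t₀ ≤ n →
      B μ (n + 1) * A μ n ≤ B μ n * A μ (n + 1) → B μ (n + 2) * A μ (n + 1) < B μ (n + 1) * A μ (n + 2)) :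
    ∃ (β₀ : ℝ) (t₀ : ℕ) (ℓ : ℝ → ℕ), Tendsto ℓ atTop atTop ∧ ∀ β : ℝ, β₀ ≤ β → ∀ μ ∈ M β,
      ∃ tstar : ℕ, ℓ β ≤ tstar ∧ (∀ n : ℕ, t₀ ≤ n → n < tstar → B μ n * A μ (n + 1) < B μ (n + 1) * A μ n) ∧
        B μ (tstar + 1) * A μ tstar ≤ B μ tstar * A μ (tstar + 1) ∧
          (∀ n : ℕ, tstar < n → B μ (n + 1) * A μ n < B μ n * A μ (n + 1)) := by
  classical
  obtain ⟨β₁, t₁, ℓ, hℓ, hUV⟩ := hUV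
  obtain ⟨β₂, t₂, hSP⟩ := hSP
  refine ⟨max (max β₁ β₂) 1, max t₁ t₂, ℓ, hℓ, fun β hβ μ hμ => ?_⟩
  have hβ₁ : β₁ ≤ β := le_trans (le_trans (le_max_left _ _) (le_max_left _ _)) hβ
  have hβ₂ : β₂ ≤ β := le_trans (le_trans (le_max_right _ _) (le_max_left _ _)) hβ
  have hβ0 : 0 < β := lt_of_lt_of_le one_pos (le_trans (le_max_right _ _) hβ)
  -- the first non-rise index at or after `max (ℓ β) (max t₁ t₂)` exists by the infrared fall
  obtain ⟨n₀, hn₀⟩ := hIF β hβ0 μ hμ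
  let Q : ℕ → Prop := fun n => max (ℓ β) (max t₁ t₂) ≤ n ∧ B μ (n + 1) * A μ n ≤ B μ n * A μ (n + 1)
  have hQ : ∃ n, Q n := by
    refine ⟨max n₀ (max (ℓ β) (max t₁ t₂)), le_max_right _ _, ?_⟩
    exact (hn₀ _ (le_max_left _ _)).2.2.le
  set tstar := Nat.find hQ with htstar
  have hspec : Q tstar := Nat.find_spec hQ
  have hmin : ∀ n, n < tstar → ¬ Q n := fun n hn => Nat.find_min hQ hn
  refine ⟨tstar, le_trans (le_max_left _ _) hspec.1, fun n hn hlt => ?_, hspec.2, ?_⟩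
  · -- rise below the turning point
    by_cases hnl : n < ℓ β
    · exact (hUV β hβ₁ μ hμ n (le_trans (le_max_left _ _) hn) hnl).2.2
    · push Not at hnl
      have hQn := hmin n hlt
      have hge : max (ℓ β) (max t₁ t₂) ≤ n := max_le hnl hn
      have : ¬ B μ (n + 1) * A μ n ≤ B μ n * A μ (n + 1) := fun h => hQn ⟨hge, h⟩
      exact lt_of_not_ge this
  · -- strict fall after the turning point, by induction with the single-peak rule
    have ht₂ : t₂ ≤ tstar := le_trans (le_trans (le_max_right _ _) (le_max_right _ _)) hspec.1
    have key : ∀ n : ℕ, tstar + 1 ≤ n → B μ (n + 1) * A μ n < B μ n * A μ (n + 1) := by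
      intro n hn
      induction n, hn using Nat.le_induction with
      | base => exact hSP β hβ₂ μ hμ tstar ht₂ hspec.2
      | succ k hk ih => exact hSP β hβ₂ μ hμ k (by omega) ih.le
    exact fun n hn => key n hn

/-- **Item stmt-QuantumFields-11703 `DualityDefect.Assembly` holds.** [folklore] -/
theorem dualityDefect_assembly_proof :
    Summit.QuantumFields.YangMills.Theses.DualityDefect.Assembly := by
  intro hIF hUV hSP G _ _ _ _ _ _ hG r S P e A B
  exact exists_peak_of_rise_fall_singlePeak A B
    (fun β => Literature.MathematicalPhysics.QuantumLattice.infiniteVolumeLimitPoints (d := 4) r.ρ β)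
    (hIF G hG r) (hUV G hG r) (hSP G hG r)

end Summit.QuantumFields.YangMills.Theorems
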